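import Summits.HodgeConjecture.CorCM.RationalExteriorAlgebra
import HarnessLib

/-!
# COR-CM fact N1 `Fact_cupExterior`, scheme-level form: `⋀^{k+1} H¹(A(ℂ); ℚ) ≅ H^{k+1}(A(ℂ); ℚ)` by the
# LEFT-bracketed iterated cup product, for every complex abelian variety

HONEST FRAMING (cell pub-hodgecm2 / COR-CM): a STANDARD fact about Betti cohomology; nothing about algebraic
cycles.

The stage-1 package (`HodgeCM/Geometry/CupFacts.lean`, ported as `CorCM/Geometry/CupFacts.lean`) states fact N1
`Fact_cupExterior` — "`H•(A′, ℚ) = ⋀• H¹(A′, ℚ)` via the cup product" for the CM products `A′ = ∏ⱼ A_{(F,Θⱼ)}` —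
through `Universe.CupExterior X k`: there is a BIJECTIVE `ℚ`-linear `e : ⋀^{k+1} H¹(X, ℚ) → H^{k+1}(X, ℚ)` with
`e (a₀ ∧ ⋯ ∧ a_k) = cupPow X k a`, where `Universe.cupPow` is the LEFT-bracketed iterated cup product
`((a₀ ∪ a₁) ∪ a₂) ∪ ⋯ ∪ a_k` (`cupPow X 0 a = a₀`, `cupPow X (k+1) a = cup X (k+1) 1 (cupPow X k (init a)) (a last)`).

This file proves the scheme-level form `exists_exterior_equiv_of_cupPow`: for `X = B.X` the variety of a
complex abelian variety and ANY function `cp` satisfying the two recursion equations of `cupPow` in the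
`BettiUniverse.cup` spelling, such an `e` exists — namely the tree's comparison map `wedgeToCup ℚ (X(ℂ)) (k+1)`
(bijective: `hasExteriorCohomologyH1_rat`, `CorCM/RationalExteriorAlgebra.lean`; Mumford §1 (4),
Lange–Birkenhake Lemma 1.1.17), whose value on a pure wedge is the RIGHT-bracketed product
`a₀ ∪ (a₁ ∪ ⋯ (a_k ∪ 1))` (`cupPowOne`); the re-bracketing `cupPowOne_eq_of_leftBracketed` is associativity
and the unit of the cup product (Hatcher §3.2). The junction for the model universe instantiates `cp` with
`Universe.cupPow` (its two equations hold by `rfl`) and `X` with the scheme of the CM product code, which IS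
the variety of a product abelian variety (`Milne1999.exists_isOfCMType_of_isCMAbelianVariety`).

## References
* [MumfordAV1970] D. Mumford, *Abelian Varieties* (1970), §1 (4).
* [LangeBirkenhake1992] H. Lange, Ch. Birkenhake, *Complex Abelian Varieties* (1992), Lemma 1.1.17, Cor. 1.1.19.
* [HatcherAT2002] A. Hatcher, *Algebraic Topology* (2002), §3.2 (associativity, unit).
-/

noncomputable section

open CategoryTheory
open Literature.AlgebraicTopology.SingularHomology
open Literature.AlgebraicGeometry Literature.AlgebraicGeometry.Motives Literature.AlgebraicGeometry.HodgeTheory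

namespace Summit.HodgeConjecture.CorCM.Model

section Bracketing

variable {R : Type} [CommRing R] {Y : Type} [TopologicalSpace Y]

/-- Moving the last factor out of the right-bracketed product:
`m_{k+2}(b) = m_{k+1}(init b) ∪ b_{k+1}`. [cite: HatcherAT2002, §3.2] -/
theorem cupPowOne_eq_cup_init_last (k : ℕ) (b : Fin (k + 2) → singularCohomology R R Y 1) :
    cupPowOne R Y (k + 2) b =
      cupProduct (rfl : (k + 1) + 1 = k + 2) (cupPowOne R Y (k + 1) (Fin.init b)) (b (Fin.last (k + 1))) := by
  induction k with
  | zero =>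
    rw [cupPowOne_succ, cupPowOne_one, cupPowOne_one]
    rfl
  | succ k ih =>
    rw [cupPowOne_succ, ih (Fin.tail b)]
    have hinit : Fin.init b = Fin.cons (b 0) (Fin.init (Fin.tail b)) := by
      rw [← Fin.tail_init_eq_init_tail]
      exact (Fin.cons_self_tail (Fin.init b)).symm
    rw [hinit, ← cupProduct_cupPowOne]
    exact (cupProduct_assoc (Nat.add_comm 1 (k + 1)) rfl rfl (Nat.add_comm 1 (k + 2)) (b 0)
      (cupPowOne R Y (k + 1) (Fin.init (Fin.tail b))) (Fin.tail b (Fin.last (k + 1)))).symm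

/-- **Re-bracketing.** The right-bracketed product `m_{k+1}(a) = a₀ ∪ (a₁ ∪ ⋯ (a_k ∪ 1))` equals any
LEFT-bracketed iterated cup product `cp k a = ((a₀ ∪ a₁) ∪ ⋯) ∪ a_k` given by the recursion
`cp 0 a = a₀`, `cp (k+1) a = cp k (init a) ∪ a_{k+1}`. [cite: HatcherAT2002, §3.2] -/
theorem cupPowOne_eq_of_leftBracketed
    (cp : (k : ℕ) → (Fin (k + 1) → singularCohomology R R Y 1) → singularCohomology R R Y (k + 1))
    (h0 : ∀ a, cp 0 a = a 0)
    (hsucc : ∀ (k : ℕ) (a : Fin (k + 2) → singularCohomology R R Y 1),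
      cp (k + 1) a = cupProduct (rfl : (k + 1) + 1 = (k + 1) + 1) (cp k (Fin.init a)) (a (Fin.last (k + 1))))
    (k : ℕ) (a : Fin (k + 1) → singularCohomology R R Y 1) :
    cupPowOne R Y (k + 1) a = cp k a := by
  induction k with
  | zero => rw [cupPowOne_one, h0]
  | succ k ih =>
    rw [cupPowOne_eq_cup_init_last, ih (Fin.init a), hsucc]

end Bracketing

section AbelianVariety

/-- **Fact N1 (`Fact_cupExterior`), scheme-level form.** Let `X/ℂ` be the underlying variety of a complex
abelian variety and `cp` a left-bracketed iterated cup product on `H¹(X(ℂ); ℚ)` in the `BettiUniverse.cup`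
spelling (`cp 0 a = a₀`, `cp (k+1) a = cup X (k+1) 1 (cp k (init a)) (a last)` — the package's `cupPow`).
Then for every `k` there is a bijective `ℚ`-linear map `⋀^{k+1} H¹(X(ℂ); ℚ) → H^{k+1}(X(ℂ); ℚ)` sending
`a₀ ∧ ⋯ ∧ a_k` to `cp k a` (`H•(A) = ⋀• H¹(A)`, Mumford §1 (4)).
[cite: MumfordAV1970, §1 (4)] [cite: LangeBirkenhake1992, Lemma 1.1.17 and Cor. 1.1.19] -/
theorem exists_exterior_equiv_of_cupPow {X : SchemeOver ℂ} (hX : ∃ B : AbelianVariety ℂ, B.X = X)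
    (cp : (k : ℕ) → (Fin (k + 1) → bettiCohomology X 1) → bettiCohomology X (k + 1))
    (h0 : ∀ a, cp 0 a = a 0)
    (hsucc : ∀ (k : ℕ) (a : Fin (k + 2) → bettiCohomology X 1),
      cp (k + 1) a = BettiUniverse.cup X (k + 1) 1 (cp k (Fin.init a)) (a (Fin.last (k + 1))))
    (k : ℕ) :
    ∃ e : (⋀[ℚ]^(k + 1) (bettiCohomology X 1)) →ₗ[ℚ] bettiCohomology X (k + 1),
      Function.Bijective e ∧
        ∀ a : Fin (k + 1) → bettiCohomology X 1, e (exteriorPower.ιMulti ℚ (k + 1) a) = cp k a := by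
  obtain ⟨B, rfl⟩ := hX
  refine ⟨wedgeToCup ℚ (ComplexPoints B.X) (k + 1), hasExteriorCohomologyH1_rat B (k + 1), fun a ↦ ?_⟩
  rw [wedgeToCup_ιMulti]
  exact cupPowOne_eq_of_leftBracketed cp h0 hsucc k a

end AbelianVariety

end Summit.HodgeConjecture.CorCM.Model

end
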